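import Literature.NumberTheory.DiophantineGeometry.BelyiMapSignatureTwoThreeTriple
import HarnessLib

/-!
# Coverings of signature `(2, 3, 5m)` for all `m`: one Kummer layer over the icosahedral seed

Topic: `Literature/NumberTheory/DiophantineGeometry`. Theorem-only file (no definition, no named
fact), the third of the chain `BelyiMapSignatureTwoThreeEven` (`(2, 3, 2m)`, dihedral seed),
`BelyiMapSignatureTwoThreeTriple` (`(2, 3, 3m)`, tetrahedral seed) attached to the named fact
`AbcWave0.darmonGranville1995_thm_2` and to Pasten's Lemma 6.10
(`Literature.NumberTheory.EllipticCurves.PastenShimura2024_lemma_6_10`). It constructs EXPLICITLY, in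
the tree's function-field language and in exactly the shape consumed by
`finite_properSolutions_of_belyiMap_of_faltings` (`AbcDarmonGranvilleSignatureReduction`), a covering
of `ℙ¹` of signature `(2, 3, 5m)` over a number field for every `m ≥ 1`
(`AlgFunctionField.exists_belyiMap_signature_two_three_five`), whence Darmon–Granville's Theorem 2
for the signatures `(2, 3, r)` with `5 ∣ r`, `r ≥ 10`, modulo Faltings' theorem ONLY
(`finite_properSolutions_signature_two_three_five_of_faltings`,
`finite_properSolutions_signature_five_two_three_of_faltings`), and — together with the two
companions — for ALL `r ≥ 8` not prime to `30`
(`finite_properSolutions_signature_r_two_three_of_faltings_of_not_coprime_thirty`). No Riemann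
existence theorem is used.

Why this goes beyond the companions. For `gcd(r, 6) = 1` the triangle group `Δ(2, 3, r)` is perfect,
so no tower of Kummer layers over a CYCLIC seed on the `j`-line has signature `(2, 3, r)`; but a
Kummer layer over a NON-SOLVABLE rational seed is not excluded. The icosahedral quotient
`ℙ¹ → ℙ¹/A₅` (Klein 1884) is such a seed: a rational function of degree `60`, defined over `ℚ`, with
uniform ramification `(2, 3, 5)`, and one cyclic layer of degree `m` branched exactly at its twelve
poles raises the signature to `(2, 3, 5m)` — reaching the perfect signatures `(2, 3, 25)`,
`(2, 3, 35)`, `(2, 3, 55)`, … . (The remaining perfect signatures `(2, 3, r)`, `gcd(r, 30) = 1`, would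
need the Klein quartic (`r = 7k`) or the modular curves `X(r)`; they are not treated.)

## The construction

Klein's icosahedral forms, dehomogenised (the twelfth vertex at `v = ∞`):
`𝔣 = X¹¹ + 11 X⁶ - X` (vertices), `ℌ = -X²⁰ + 228 X¹⁵ - 494 X¹⁰ - 228 X⁵ - 1` (faces),
`𝔗 = X³⁰ + 522 X²⁵ - 10005 X²⁰ - 10005 X¹⁰ - 522 X⁵ + 1` (edges), with **Klein's identity**
`ℌ³ + 𝔗² = 1728 𝔣⁵` (`icoH_pow_add_icoT_pow`) and the two Wronskian identities
`2 𝔗' 𝔣 - 5 𝔗 𝔣' = 5 ℌ²`, `3 ℌ' 𝔣 - 5 ℌ 𝔣' = -5 𝔗` (`wronskian_icoT_icoF`, `wronskian_icoH_icoF`), all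
checked by `ring`. From ONE Euclidean computation, `IsCoprime ℌ 𝔣` (`isCoprime_icoH_icoF`:
`ℌ = 𝔮 (-X¹⁰ + 239 X⁵ - 3124) + 3125 (11 X⁵ - 1)`, `121 𝔮 - (11 X⁵ - 1)(11 X⁵ + 122) = 1`,
`𝔣 = X 𝔮`), Klein's identity gives the pairwise coprimality of `𝔗, ℌ, 𝔣` and the Wronskians give
their separability (a repeated factor of `𝔗` would divide `5 ℌ²`, etc.). The **icosahedral seed** on
the line `K(v)` is
`𝔤 = 𝔗(v)²/(1728 𝔣(v)⁵)`, `𝔤 - 1 = -ℌ(v)³/(1728 𝔣(v)⁵)`,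
with zeros of order `2` (at `𝔗(v) = 0`), zeros of `𝔤 - 1` of order `3` (at `ℌ(v) = 0`), poles of
order `5` (at `v = ∞` and `𝔣(v) = 0`), and unramified over every other closed point of the
`𝔤`-line (`seedI_cases`, `seedI_elsewhere` — the latter by the tool `pullback_separable` of the even
companion with `A = 𝔗²`, `B = 1728 𝔣⁵`, `A - B = -ℌ³`, Wronskian `A'B - AB' = 1728 𝔗 𝔣⁴ · 5 ℌ²`).
Over a field containing the golden ratio `φ` (`φ² = φ + 1`; over `ℚ`: `ℚ(ζ₅)`, `φ = -(ζ² + ζ³)`),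
`𝔣 = 𝔭₁ 𝔭₂` with `𝔭₁ = X (X⁵ - (5φ - 8))`, `𝔭₂ = X⁵ + (5φ + 3)` (`5φ + 3 = φ⁵`, `5φ - 8 = φ⁻⁵`), and
ONE Kummer layer of degree `m`,
`F₁ = K(v)(g)`, `g^m = h = 𝔭₁ 𝔭₂^{m-1}`,
is totally ramified above each pole (there `v(h) ∈ {-5m - 1, 1, m - 1}` is prime to `m`) and
unramified everywhere else (`v(h) = 0`), by Stichtenoth Prop. 3.7.3 in the two extreme cases of the
tree's `FunctionFieldRadicalLayerSignature`. Hence `𝔤 ∈ F₁` has zeros of order `2`, `𝔤 - 1` zeros of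
order `3`, poles of order `5m`, and `F₁/K(𝔤)` is unramified over the other closed points; finally `K`
is replaced by the full constant field of `F₁` (`exists_fullConstantField_of_signature`).

Implementation note: the forms are local notations with fully ascribed leaves (every `X`, numeral
and exponent carries its type) — without the ascriptions the postponed default-instance problems of a
statement mentioning the degree-`30` form a dozen times exhaust the elaborator.

## References

* F. Klein, *Vorlesungen über das Ikosaeder und die Auflösung der Gleichungen vom fünften Grade*,
  Teubner, Leipzig 1884: Part I, Ch. II, §§12–13 (the forms `f, H, T` and `H³ + T² = 1728 f⁵`).
* H. Darmon, A. Granville, *On the equations `z^m = F(x, y)` and `A x^p + B y^q = C z^r`*, Bull. London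
  Math. Soc. 27 (1995) 513–543: Theorem 2 (p. 515), Prop. 3.1 (p. 525). [DarmonGranville1995]
* H. Stichtenoth, *Algebraic Function Fields and Codes*, GTM 254, 2009: Prop. 3.7.3 (Kummer
  extensions), Thm. 3.1.11, Prop. 1.1.5, Cor. 1.1.20. [Stichtenoth2009]
* H. Pasten, *Shimura curves and the abc conjecture*, J. Number Theory 254 (2024) 214–335
  (arXiv:1705.09251), §6.5, Lemma 6.10. [PastenShimura2024]
-/

noncomputable section

open scoped Classical Polynomial IntermediateField

namespace Literature.NumberTheory.DiophantineGeometry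

open Polynomial

universe u v

namespace AlgFunctionField

/-! ### A. Klein's icosahedral forms `𝔣` (vertices), `ℌ` (faces), `𝔗` (edges) -/

/-- `𝔮 = X¹⁰ + 11 X⁵ - 1` (the eleven finite vertices other than `0` are the roots of `X 𝔮`;
local notation). -/
local notation3 "𝔮(" K ")" =>
  ((X : Polynomial K) ^ (10 : ℕ) + (11 : Polynomial K) * (X : Polynomial K) ^ (5 : ℕ) - (1 : Polynomial K))

/-- Klein's vertex form `𝔣 = X¹¹ + 11 X⁶ - X = X 𝔮` (dehomogenised; the twelfth vertex is `∞`;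
local notation). -/
local notation3 "𝔣(" K ")" =>
  ((X : Polynomial K) ^ (11 : ℕ) + (11 : Polynomial K) * (X : Polynomial K) ^ (6 : ℕ) - (X : Polynomial K))

/-- Klein's face form `ℌ = -X²⁰ + 228 X¹⁵ - 494 X¹⁰ - 228 X⁵ - 1` (local notation). -/
local notation3 "ℌ(" K ")" =>
  (-(X : Polynomial K) ^ (20 : ℕ) + (228 : Polynomial K) * (X : Polynomial K) ^ (15 : ℕ) -
    (494 : Polynomial K) * (X : Polynomial K) ^ (10 : ℕ) - (228 : Polynomial K) * (X : Polynomial K) ^ (5 : ℕ) -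
    (1 : Polynomial K))

/-- Klein's edge form `𝔗 = X³⁰ + 522 X²⁵ - 10005 X²⁰ - 10005 X¹⁰ - 522 X⁵ + 1` (local notation). -/
local notation3 "𝔗(" K ")" =>
  ((X : Polynomial K) ^ (30 : ℕ) + (522 : Polynomial K) * (X : Polynomial K) ^ (25 : ℕ) -
    (10005 : Polynomial K) * (X : Polynomial K) ^ (20 : ℕ) - (10005 : Polynomial K) * (X : Polynomial K) ^ (10 : ℕ) -
    (522 : Polynomial K) * (X : Polynomial K) ^ (5 : ℕ) + (1 : Polynomial K))

section Forms

variable {K : Type u} [Field K]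

/-- `deg 𝔮 = 10`. [folklore] -/
theorem natDegree_icoQ : (𝔮(K)).natDegree = 10 := by compute_degree!

/-- `deg 𝔣 = 11`. [folklore] -/
theorem natDegree_icoF : (𝔣(K)).natDegree = 11 := by compute_degree!

/-- `deg ℌ = 20`. [folklore] -/
theorem natDegree_icoH : (ℌ(K)).natDegree = 20 := by compute_degree!

/-- `deg 𝔗 = 30`. [folklore] -/
theorem natDegree_icoT : (𝔗(K)).natDegree = 30 := by compute_degree!

/-- `𝔮, 𝔣, ℌ, 𝔗 ≠ 0`. [folklore] -/
theorem ico_ne_zero : 𝔮(K) ≠ 0 ∧ 𝔣(K) ≠ 0 ∧ ℌ(K) ≠ 0 ∧ 𝔗(K) ≠ 0 := by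
  refine ⟨fun h => ?_, fun h => ?_, fun h => ?_, fun h => ?_⟩
  · have := natDegree_icoQ (K := K); rw [h, natDegree_zero] at this; exact absurd this (by norm_num)
  · have := natDegree_icoF (K := K); rw [h, natDegree_zero] at this; exact absurd this (by norm_num)
  · have := natDegree_icoH (K := K); rw [h, natDegree_zero] at this; exact absurd this (by norm_num)
  · have := natDegree_icoT (K := K); rw [h, natDegree_zero] at this; exact absurd this (by norm_num)

/-- `𝔣 = X 𝔮`. [folklore] -/
theorem icoF_eq_X_mul : 𝔣(K) = X * 𝔮(K) := by ring

/-- `ℌ(0) = -1`, `𝔗(0) = 1`, `𝔮(0) = -1`. [folklore] -/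
theorem ico_eval_zero : (ℌ(K)).eval 0 = -1 ∧ (𝔗(K)).eval 0 = 1 ∧ (𝔮(K)).eval 0 = -1 := by
  refine ⟨?_, ?_, ?_⟩ <;> simp

/-- **Klein's icosahedral identity** `ℌ³ + 𝔗² = 1728 𝔣⁵` (F. Klein, *Vorlesungen über das Ikosaeder*
(1884), I.2 §13). [folklore] -/
theorem icoH_pow_add_icoT_pow : ℌ(K) ^ 3 + 𝔗(K) ^ 2 = 1728 * 𝔣(K) ^ 5 := by ring

/-- The derivative of `𝔣`. [folklore] -/
theorem derivative_icoF : derivative 𝔣(K) = 11 * X ^ 10 + 66 * X ^ 5 - 1 := by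
  simp only [derivative_sub, derivative_add, derivative_mul, derivative_X_pow, derivative_X,
    derivative_ofNat, Nat.cast_ofNat, zero_mul, zero_add, map_ofNat]
  norm_num; ring

/-- The derivative of `ℌ`. [folklore] -/
theorem derivative_icoH :
    derivative ℌ(K) = -(20 * X ^ 19) + 3420 * X ^ 14 - 4940 * X ^ 9 - 1140 * X ^ 4 := by
  simp only [derivative_sub, derivative_add, derivative_neg, derivative_mul, derivative_X_pow,
    derivative_one, derivative_ofNat, Nat.cast_ofNat, zero_mul, zero_add, map_ofNat]
  norm_num; ring

/-- The derivative of `𝔗`. [folklore] -/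
theorem derivative_icoT :
    derivative 𝔗(K) = 30 * X ^ 29 + 13050 * X ^ 24 - 200100 * X ^ 19 - 100050 * X ^ 9 - 2610 * X ^ 4 := by
  simp only [derivative_sub, derivative_add, derivative_mul, derivative_X_pow,
    derivative_one, derivative_ofNat, Nat.cast_ofNat, zero_mul, zero_add, map_ofNat]
  norm_num; ring

/-- **First Wronskian identity** `2 𝔗' 𝔣 - 5 𝔗 𝔣' = 5 ℌ²` (the derivative of `𝔗²/𝔣⁵` vanishes
doubly at the face centres). [folklore] -/
theorem wronskian_icoT_icoF :
    2 * derivative 𝔗(K) * 𝔣(K) - 5 * 𝔗(K) * derivative 𝔣(K) = 5 * ℌ(K) ^ 2 := by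
  rw [derivative_icoT, derivative_icoF]; ring

/-- **Second Wronskian identity** `3 ℌ' 𝔣 - 5 ℌ 𝔣' = -5 𝔗` (the derivative of `ℌ³/𝔣⁵` vanishes at
the edge midpoints). [folklore] -/
theorem wronskian_icoH_icoF :
    3 * derivative ℌ(K) * 𝔣(K) - 5 * ℌ(K) * derivative 𝔣(K) = -5 * 𝔗(K) := by
  rw [derivative_icoH, derivative_icoF]; ring

variable [CharZero K]

/-- A non-zero natural number is a unit constant in `K[X]` (`char K = 0`). [folklore] -/
theorem isUnit_C_ofNat {n : ℕ} (hn : n ≠ 0) : IsUnit (C (n : K) : K[X]) :=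
  isUnit_C.mpr (Nat.cast_ne_zero.mpr hn).isUnit

/-- **`ℌ` and `𝔣 = X 𝔮` are coprime**: `ℌ ≡ -1 (mod X)`, and the Euclidean algorithm
`ℌ = 𝔮 (-X¹⁰ + 239 X⁵ - 3124) + 3125 (11 X⁵ - 1)`, `121 𝔮 - (11 X⁵ - 1)(11 X⁵ + 122) = 1`.
[folklore] -/
theorem isCoprime_icoH_icoF : IsCoprime ℌ(K) 𝔣(K) := by
  -- `ℌ` and `X`
  have hX : IsCoprime ℌ(K) X := by
    have h := ((isCoprime_one_left (x := (X : K[X]))).neg_left).add_mul_left_left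
      (-X ^ 19 + 228 * X ^ 14 - 494 * X ^ 9 - 228 * X ^ 4)
    have e : (-1 + X * (-X ^ 19 + 228 * X ^ 14 - 494 * X ^ 9 - 228 * X ^ 4) : K[X]) = ℌ(K) := by ring
    rwa [e] at h
  -- `𝔮` and `11 X⁵ - 1`
  have h11 : IsCoprime 𝔮(K) (11 * X ^ 5 - 1) :=
    ⟨121, -(11 * X ^ 5 + 122), by ring⟩
  have hu : IsUnit (C ((3125 : ℕ) : K) : K[X]) := isUnit_C_ofNat (by norm_num)
  have h3125 : IsCoprime 𝔮(K) (C ((3125 : ℕ) : K)) := by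
    simpa using (isCoprime_mul_unit_left_right hu 𝔮(K) 1).2 isCoprime_one_right
  have h0 : IsCoprime 𝔮(K) (C ((3125 : ℕ) : K) * (11 * X ^ 5 - 1)) := h3125.mul_right h11
  have h1 := h0.add_mul_left_right (-X ^ 10 + 239 * X ^ 5 - 3124)
  have e : (C ((3125 : ℕ) : K) * (11 * X ^ 5 - 1) + 𝔮(K) * (-X ^ 10 + 239 * X ^ 5 - 3124) : K[X]) =
      ℌ(K) := by
    simp only [Nat.cast_ofNat, map_ofNat]; ring
  rw [e] at h1
  rw [icoF_eq_X_mul]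
  exact hX.mul_right h1.symm

/-- `𝔗` and `𝔣` are coprime (a common factor would divide `ℌ³ = 1728 𝔣⁵ - 𝔗²`). [folklore] -/
theorem isCoprime_icoT_icoF : IsCoprime 𝔗(K) 𝔣(K) := by
  obtain ⟨-, hF, -, -⟩ := ico_ne_zero (K := K)
  refine isCoprime_of_irreducible_dvd (fun h => hF h.2) fun ρ hρ hT hf => ?_
  have hH3 : ρ ∣ ℌ(K) ^ 3 := by
    have e : ℌ(K) ^ 3 = 1728 * 𝔣(K) ^ 5 - 𝔗(K) ^ 2 := by rw [← icoH_pow_add_icoT_pow]; ring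
    rw [e]
    exact dvd_sub (dvd_mul_of_dvd_right (hf.trans (dvd_pow_self _ (by norm_num))) _)
      (hT.trans (dvd_pow_self _ two_ne_zero))
  exact hρ.not_isUnit (isCoprime_icoH_icoF.isUnit_of_dvd' (hρ.prime.dvd_of_dvd_pow hH3) hf)

/-- `𝔗` and `ℌ` are coprime (a common factor would divide `1728 𝔣⁵`). [folklore] -/
theorem isCoprime_icoT_icoH : IsCoprime 𝔗(K) ℌ(K) := by
  obtain ⟨-, -, hH, -⟩ := ico_ne_zero (K := K)
  refine isCoprime_of_irreducible_dvd (fun h => hH h.2) fun ρ hρ hT hH' => ?_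
  have hp := hρ.prime
  have h5 : ρ ∣ C ((1728 : ℕ) : K) * 𝔣(K) ^ 5 := by
    have e : C ((1728 : ℕ) : K) * 𝔣(K) ^ 5 = ℌ(K) ^ 3 + 𝔗(K) ^ 2 := by
      rw [icoH_pow_add_icoT_pow]; simp only [Nat.cast_ofNat, map_ofNat]
    rw [e]
    exact dvd_add (hH'.trans (dvd_pow_self _ three_ne_zero)) (hT.trans (dvd_pow_self _ two_ne_zero))
  rcases hp.dvd_or_dvd h5 with h | h
  · exact hρ.not_isUnit (isUnit_of_dvd_unit h (isUnit_C_ofNat (by norm_num)))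
  · exact hρ.not_isUnit (isCoprime_icoT_icoF.isUnit_of_dvd' hT (hp.dvd_of_dvd_pow h))

/-- **`𝔗` is separable**: a repeated factor would divide `5 ℌ² = 2 𝔗' 𝔣 - 5 𝔗 𝔣'`. [folklore] -/
theorem separable_icoT : (𝔗(K)).Separable := by
  obtain ⟨-, -, -, hT⟩ := ico_ne_zero (K := K)
  rw [separable_def]
  refine isCoprime_of_irreducible_dvd (fun h => hT h.1) fun ρ hρ h1 h2 => ?_
  have hp := hρ.prime
  have h5 : ρ ∣ C ((5 : ℕ) : K) * ℌ(K) ^ 2 := by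
    have e : C ((5 : ℕ) : K) * ℌ(K) ^ 2 = 2 * derivative 𝔗(K) * 𝔣(K) - 5 * 𝔗(K) * derivative 𝔣(K) := by
      rw [wronskian_icoT_icoF]; simp only [Nat.cast_ofNat, map_ofNat]
    rw [e]
    exact dvd_sub (dvd_mul_of_dvd_left (dvd_mul_of_dvd_right h2 _) _)
      (dvd_mul_of_dvd_left (dvd_mul_of_dvd_right h1 _) _)
  rcases hp.dvd_or_dvd h5 with h | h
  · exact hρ.not_isUnit (isUnit_of_dvd_unit h (isUnit_C_ofNat (by norm_num)))
  · exact hρ.not_isUnit (isCoprime_icoT_icoH.isUnit_of_dvd' h1 (hp.dvd_of_dvd_pow h))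

/-- **`ℌ` is separable**: a repeated factor would divide `-5 𝔗 = 3 ℌ' 𝔣 - 5 ℌ 𝔣'`. [folklore] -/
theorem separable_icoH : (ℌ(K)).Separable := by
  obtain ⟨-, -, hH, -⟩ := ico_ne_zero (K := K)
  rw [separable_def]
  refine isCoprime_of_irreducible_dvd (fun h => hH h.1) fun ρ hρ h1 h2 => ?_
  have hp := hρ.prime
  have h5 : ρ ∣ -(C ((5 : ℕ) : K)) * 𝔗(K) := by
    have e : -(C ((5 : ℕ) : K)) * 𝔗(K) = 3 * derivative ℌ(K) * 𝔣(K) - 5 * ℌ(K) * derivative 𝔣(K) := by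
      rw [wronskian_icoH_icoF]; simp only [Nat.cast_ofNat, map_ofNat, neg_mul]
    rw [e]
    exact dvd_sub (dvd_mul_of_dvd_left (dvd_mul_of_dvd_right h2 _) _)
      (dvd_mul_of_dvd_left (dvd_mul_of_dvd_right h1 _) _)
  rcases hp.dvd_or_dvd h5 with h | h
  · exact hρ.not_isUnit (isUnit_of_dvd_unit h (isUnit_C_ofNat (K := K) (by norm_num)).neg)
  · exact hρ.not_isUnit (isCoprime_icoT_icoH.isUnit_of_dvd' h h1)

/-- **`𝔣` is separable**: a repeated factor would divide `5 ℌ²`. [folklore] -/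
theorem separable_icoF : (𝔣(K)).Separable := by
  obtain ⟨-, hF, -, -⟩ := ico_ne_zero (K := K)
  rw [separable_def]
  refine isCoprime_of_irreducible_dvd (fun h => hF h.1) fun ρ hρ h1 h2 => ?_
  have hp := hρ.prime
  have h5 : ρ ∣ C ((5 : ℕ) : K) * ℌ(K) ^ 2 := by
    have e : C ((5 : ℕ) : K) * ℌ(K) ^ 2 = 2 * derivative 𝔗(K) * 𝔣(K) - 5 * 𝔗(K) * derivative 𝔣(K) := by
      rw [wronskian_icoT_icoF]; simp only [Nat.cast_ofNat, map_ofNat]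
    rw [e]
    exact dvd_sub (dvd_mul_of_dvd_right h1 _) (dvd_mul_of_dvd_right h2 _)
  rcases hp.dvd_or_dvd h5 with h | h
  · exact hρ.not_isUnit (isUnit_of_dvd_unit h (isUnit_C_ofNat (by norm_num)))
  · exact hρ.not_isUnit (isCoprime_icoH_icoF.isUnit_of_dvd' (hp.dvd_of_dvd_pow h) h1)

omit [CharZero K] in
/-- **The golden factorisation of `𝔮`**: for `φ² = φ + 1`,
`𝔮 = (X⁵ - (5φ - 8))(X⁵ + (5φ + 3))` (`5φ + 3 = φ⁵`, `5φ - 8 = φ⁻⁵`, `φ⁵ - φ⁻⁵ = 11`,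
`φ⁵ φ⁻⁵ = 1`). [folklore] -/
theorem icoQ_eq_mul {φ : K} (hφ : φ ^ 2 = φ + 1) :
    𝔮(K) = (X ^ 5 - C (5 * φ - 8)) * (X ^ 5 + C (5 * φ + 3)) := by
  have hC : (C φ) ^ 2 = C φ + 1 := by rw [← map_pow, hφ, map_add, map_one]
  simp only [map_sub, map_add, map_mul, map_ofNat]
  linear_combination (25 : K[X]) * hC

omit [CharZero K] in
/-- `(T²)'(c F⁵) - T² (c F⁵)' = c T F⁴ (2 T' F - 5 T F')`. [folklore] -/
theorem wronskian_sq_mul_pow_five (T F : K[X]) (c : K) :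
    derivative (T ^ 2) * (C c * F ^ 5) - T ^ 2 * derivative (C c * F ^ 5) =
      C c * T * F ^ 4 * (2 * derivative T * F - 5 * T * derivative F) := by
  simp only [derivative_pow, derivative_mul, derivative_C, zero_mul, zero_add, Nat.cast_ofNat,
    Nat.add_one_sub_one, map_ofNat]
  ring

omit [CharZero K] in
/-- **The Wronskian of `A = 𝔗²` and `B = 1728 𝔣⁵`**: `A'B - AB' = 1728 𝔗 𝔣⁴ · 5 ℌ²`. [folklore] -/
theorem wronskian_ico :
    derivative (𝔗(K) ^ 2) * (C (1728 : K) * 𝔣(K) ^ 5) - 𝔗(K) ^ 2 * derivative (C (1728 : K) * 𝔣(K) ^ 5) =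
      C (1728 : K) * 𝔗(K) * 𝔣(K) ^ 4 * (5 * ℌ(K) ^ 2) := by
  rw [wronskian_sq_mul_pow_five, wronskian_icoT_icoF]

omit [CharZero K] in
/-- `𝔣 = (X (X⁵ - (5φ - 8))) (X⁵ + (5φ + 3))` for `φ² = φ + 1`. [folklore] -/
theorem icoF_eq_mul {φ : K} (hφ : φ ^ 2 = φ + 1) :
    𝔣(K) = (X * (X ^ 5 - C (5 * φ - 8))) * (X ^ 5 + C (5 * φ + 3)) := by
  rw [icoF_eq_X_mul, icoQ_eq_mul hφ]; ring

/-- `5φ - 8 ≠ 0` and `5φ + 3 ≠ 0` for `φ² = φ + 1`. [folklore] -/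
theorem golden_ne_zero {φ : K} (hφ : φ ^ 2 = φ + 1) : 5 * φ - 8 ≠ 0 ∧ 5 * φ + 3 ≠ 0 := by
  constructor
  · intro h
    have h1 : (5 * φ) ^ 2 = 25 * φ + 25 := by linear_combination 25 * hφ
    have h2 : 5 * φ = 8 := by linear_combination h
    rw [h2] at h1
    have h3 : (25 : K) * φ = 40 := by linear_combination 5 * h2
    have : (64 : K) = 65 := by linear_combination h1 + h3
    norm_num at this
  · intro h
    have h1 : (5 * φ) ^ 2 = 25 * φ + 25 := by linear_combination 25 * hφ
    have h2 : 5 * φ = -3 := by linear_combination h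
    rw [h2] at h1
    have h3 : (25 : K) * φ = -15 := by linear_combination 5 * h2
    have : (9 : K) = 10 := by linear_combination h1 + h3
    norm_num at this

omit [CharZero K] in
/-- `deg (X (X⁵ - c)) = 6` and `deg (X⁵ + c') = 5`; both are non-zero. [folklore] -/
theorem natDegree_radicands (c c' : K) :
    (X * (X ^ 5 - C c) : K[X]).natDegree = 6 ∧ (X ^ 5 + C c' : K[X]).natDegree = 5 ∧
      (X * (X ^ 5 - C c) : K[X]) ≠ 0 ∧ (X ^ 5 + C c' : K[X]) ≠ 0 := by
  have h1 : (X * (X ^ 5 - C c) : K[X]) ≠ 0 := mul_ne_zero X_ne_zero (X_pow_sub_C_ne_zero (by norm_num) c)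
  have h2 : (X ^ 5 + C c' : K[X]) ≠ 0 := by
    rw [← sub_neg_eq_add, ← map_neg]; exact X_pow_sub_C_ne_zero (by norm_num) _
  refine ⟨?_, ?_, h1, h2⟩
  · rw [natDegree_mul X_ne_zero (X_pow_sub_C_ne_zero (by norm_num) c), natDegree_X,
      natDegree_X_pow_sub_C]
  · rw [← sub_neg_eq_add, ← map_neg, natDegree_X_pow_sub_C]

end Forms


/-! ### B. The icosahedral seed `𝔤 = 𝔗(v)²/(1728 𝔣(v)⁵)` on the line `K(v)` -/

/-- `𝔗(v)`, `ℌ(v)`, `𝔣(v)` on the line `K(v)` (local notations). -/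
local notation3 "𝔗ᵥ(" K ")" => (aeval (RatFunc.X : RatFunc K) 𝔗(K))
local notation3 "ℌᵥ(" K ")" => (aeval (RatFunc.X : RatFunc K) ℌ(K))
local notation3 "𝔣ᵥ(" K ")" => (aeval (RatFunc.X : RatFunc K) 𝔣(K))

/-- The icosahedral seed `𝔤 = 𝔗(v)²/(1728 𝔣(v)⁵)`, the quotient map `ℙ¹ → ℙ¹/A₅` (local notation). -/
local notation3 "𝔤(" K ")" =>
  ((𝔗ᵥ(K)) ^ (2 : ℕ) / (algebraMap K (RatFunc K) (1728 : K) * (𝔣ᵥ(K)) ^ (5 : ℕ)) : RatFunc K)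

/-- The two factors `𝔭₁ = v (v⁵ - (5φ - 8))`, `𝔭₂ = v⁵ + (5φ + 3)` of `𝔣(v) = 𝔭₁ 𝔭₂` entering the
radicand `𝔭₁ 𝔭₂^{m-1}` of the Kummer layer (local notations). -/
local notation3 "𝔭₁(" K ", " φ ")" =>
  (aeval (RatFunc.X : RatFunc K) ((X : Polynomial K) * ((X : Polynomial K) ^ (5 : ℕ) - C (5 * φ - 8))))
local notation3 "𝔭₂(" K ", " φ ")" =>
  (aeval (RatFunc.X : RatFunc K) ((X : Polynomial K) ^ (5 : ℕ) + C (5 * φ + 3)))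

section Seed

variable {K : Type u} [Field K]

/-- **At most one of two coprime polynomials vanishes at a place**: for `x ∈ 𝒪_P` and `p, q ∈ K[X]`
coprime, `v_P(p(x))` and `v_P(q(x))` are not both positive (`a p + b q = 1` reduces to `0 = 1` in the
residue field). [folklore] -/
theorem PlaceOver.not_and_ord_aeval_pos_of_isCoprime {F : Type v} [Field F] [Algebra K F]
    [IsAlgFunctionField K F] (P : PlaceOver K F) {x : F} (hx : x ∈ P.toValuationSubring)
    {p q : K[X]} (hpq : IsCoprime p q) (hp : aeval x p ≠ 0) (hq : aeval x q ≠ 0) :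
    ¬ (0 < P.ord (aeval x p) ∧ 0 < P.ord (aeval x q)) := by
  rintro ⟨h1, h2⟩
  rw [P.ord_aeval_pos_iff hx hp] at h1
  rw [P.ord_aeval_pos_iff hx hq] at h2
  obtain ⟨a, b, hab⟩ := hpq
  have key := congr_arg (aeval (IsLocalRing.residue P.toValuationSubring ⟨x, hx⟩)) hab
  rw [map_add, map_mul, map_mul, h1, h2, mul_zero, mul_zero, add_zero, map_one] at key
  exact zero_ne_one key

/-- Non-vanishing on the line: `𝔗(v)`, `ℌ(v)`, `𝔣(v)`, `𝔭₁`, `𝔭₂`. [folklore] -/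
theorem seedI_ne_zero (φ : K) :
    𝔗ᵥ(K) ≠ 0 ∧ ℌᵥ(K) ≠ 0 ∧ 𝔣ᵥ(K) ≠ 0 ∧ 𝔭₁(K, φ) ≠ 0 ∧ 𝔭₂(K, φ) ≠ 0 := by
  obtain ⟨-, hF, hH, hT⟩ := ico_ne_zero (K := K)
  obtain ⟨-, -, h1, h2⟩ := natDegree_radicands (K := K) (5 * φ - 8) (5 * φ + 3)
  exact ⟨aeval_ratFunc_X_ne_zero hT, aeval_ratFunc_X_ne_zero hH, aeval_ratFunc_X_ne_zero hF,
    aeval_ratFunc_X_ne_zero h1, aeval_ratFunc_X_ne_zero h2⟩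

/-- `𝔤 = A(v)/B(v)` with `A = 𝔗²`, `B = 1728 𝔣⁵`. [folklore] -/
theorem seedI_eq_div :
    𝔤(K) = aeval (RatFunc.X : RatFunc K) (𝔗(K) ^ 2) /
      aeval (RatFunc.X : RatFunc K) (C (1728 : K) * 𝔣(K) ^ 5) := by
  rw [map_pow, map_mul, aeval_C, map_pow]

variable [CharZero K]

/-- `1728 ≠ 0` on the line and `v_P(1728) = 0`. [folklore] -/
theorem seedI_const (P : PlaceOver K (RatFunc K)) :
    algebraMap K (RatFunc K) 1728 ≠ 0 ∧ P.ord (algebraMap K (RatFunc K) 1728) = 0 :=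
  ⟨(_root_.map_ne_zero _).2 (by norm_num), PlaceOver.ord_algebraMap_holds P (by norm_num)⟩

/-- **`𝔤 - 1 = -ℌ(v)³/(1728 𝔣(v)⁵)`** (Klein's identity). [folklore] -/
theorem seedI_sub_one :
    𝔤(K) - 1 = -(ℌᵥ(K) ^ 3) / (algebraMap K (RatFunc K) 1728 * (𝔣ᵥ(K)) ^ 5) := by
  obtain ⟨-, -, hF, -⟩ := seedI_ne_zero (K := K) 0
  have h1728 : algebraMap K (RatFunc K) 1728 ≠ 0 := (_root_.map_ne_zero _).2 (by norm_num)
  have hk : ℌᵥ(K) ^ 3 + 𝔗ᵥ(K) ^ 2 = algebraMap K (RatFunc K) 1728 * 𝔣ᵥ(K) ^ 5 := by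
    have h := congr_arg (aeval (RatFunc.X : RatFunc K)) (icoH_pow_add_icoT_pow (K := K))
    rwa [map_add, map_pow, map_pow, show (1728 : K[X]) = C (1728 : K) by rw [map_ofNat], map_mul,
      aeval_C, map_pow] at h
  rw [div_sub_one (mul_ne_zero h1728 (pow_ne_zero _ hF))]
  congr 1
  linear_combination hk

/-- **The order of the seed**: `v(𝔤) = 2 v(𝔗(v)) - 5 v(𝔣(v))`. [folklore] -/
theorem ord_seedI (P : PlaceOver K (RatFunc K)) :
    P.ord 𝔤(K) = 2 * P.ord 𝔗ᵥ(K) - 5 * P.ord 𝔣ᵥ(K) := by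
  obtain ⟨hT, -, hF, -⟩ := seedI_ne_zero (K := K) 0
  obtain ⟨h1728, ho⟩ := seedI_const (K := K) P
  rw [P.ord_div (pow_ne_zero _ hT) (mul_ne_zero h1728 (pow_ne_zero _ hF)), P.ord_pow hT,
    P.ord_mul_eq h1728 (pow_ne_zero _ hF), P.ord_pow hF, ho]
  push_cast; ring

/-- **The order of `𝔤 - 1`**: `v(𝔤 - 1) = 3 v(ℌ(v)) - 5 v(𝔣(v))`. [folklore] -/
theorem ord_seedI_sub_one (P : PlaceOver K (RatFunc K)) :
    P.ord (𝔤(K) - 1) = 3 * P.ord ℌᵥ(K) - 5 * P.ord 𝔣ᵥ(K) := by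
  obtain ⟨-, hH, hF, -⟩ := seedI_ne_zero (K := K) 0
  obtain ⟨h1728, ho⟩ := seedI_const (K := K) P
  rw [seedI_sub_one, P.ord_div (neg_ne_zero.mpr (pow_ne_zero _ hH))
    (mul_ne_zero h1728 (pow_ne_zero _ hF)), P.ord_neg, P.ord_pow hH,
    P.ord_mul_eq h1728 (pow_ne_zero _ hF), P.ord_pow hF, ho]
  push_cast; ring

/-- The seed is non-zero. [folklore] -/
theorem seedI_seed_ne_zero : 𝔤(K) ≠ 0 := by
  obtain ⟨hT, -, hF, -⟩ := seedI_ne_zero (K := K) 0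
  have h1728 : algebraMap K (RatFunc K) 1728 ≠ 0 := (_root_.map_ne_zero _).2 (by norm_num)
  exact div_ne_zero (pow_ne_zero _ hT) (mul_ne_zero h1728 (pow_ne_zero _ hF))

omit [CharZero K] in
/-- Splitting `a + b = 1` for `a, b ≥ 0` (kept outside the big case analysis so that `omega` sees a
small context). [folklore] -/
private theorem aux_split {a b : ℤ} (ha : 0 ≤ a) (hb : 0 ≤ b) (h : a + b = 1) :
    (a = 1 ∧ b = 0) ∨ (a = 0 ∧ b = 1) := by omega

omit [CharZero K] in
/-- `a + b = 0` for `a, b ≥ 0` forces `a = b = 0`. [folklore] -/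
private theorem aux_zero {a b : ℤ} (ha : 0 ≤ a) (hb : 0 ≤ b) (h : a + b = 0) : a = 0 ∧ b = 0 := by
  omega

/-- **The four kinds of places of the line for the icosahedral seed.** At every place `P` of `K(v)`
(with `φ² = φ + 1`, so `𝔣 = 𝔭₁ 𝔭₂`) one of: (poles: `v = ∞` or `𝔣(v) = 0`, the twelve vertices)
`v(𝔤) = v(𝔤 - 1) = -5` and `(v(𝔭₁), v(𝔭₂)) ∈ {(-6, -5), (1, 0), (0, 1)}`, with
`v(π₀(𝔤)) = -5 deg π₀`; (zeros: `𝔗(v) = 0`, the thirty edge midpoints) `v(𝔤) = 2`, `v(𝔤 - 1) = 0`,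
`𝔭₁, 𝔭₂` units; (ones: `ℌ(v) = 0`, the twenty face centres) `v(𝔤) = 0`, `v(𝔤 - 1) = 3`, `𝔭₁, 𝔭₂`
units; (generic) `v ∈ 𝒪_P`, `𝔣(v)` unit, `v(𝔤) = v(𝔤 - 1) = 0`, `𝔭₁, 𝔭₂` units. [folklore] -/
theorem seedI_cases {φ : K} (hφ : φ ^ 2 = φ + 1) (P : PlaceOver K (RatFunc K)) :
    (P.ord 𝔤(K) = -5 ∧ P.ord (𝔤(K) - 1) = -5 ∧
        ((P.ord 𝔭₁(K, φ) = -6 ∧ P.ord 𝔭₂(K, φ) = -5) ∨ (P.ord 𝔭₁(K, φ) = 1 ∧ P.ord 𝔭₂(K, φ) = 0) ∨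
          (P.ord 𝔭₁(K, φ) = 0 ∧ P.ord 𝔭₂(K, φ) = 1)) ∧
        ∀ π₀ : K[X], π₀ ≠ 0 → P.ord (aeval 𝔤(K) π₀) = π₀.natDegree * (-5)) ∨
      (P.ord 𝔤(K) = 2 ∧ P.ord (𝔤(K) - 1) = 0 ∧ P.ord 𝔭₁(K, φ) = 0 ∧ P.ord 𝔭₂(K, φ) = 0 ∧
        ∀ π₀ : K[X], π₀.eval 0 ≠ 0 → P.ord (aeval 𝔤(K) π₀) = 0) ∨
      (P.ord 𝔤(K) = 0 ∧ P.ord (𝔤(K) - 1) = 3 ∧ P.ord 𝔭₁(K, φ) = 0 ∧ P.ord 𝔭₂(K, φ) = 0 ∧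
        ∀ π₀ : K[X], π₀.eval 1 ≠ 0 → P.ord (aeval 𝔤(K) π₀) = 0) ∨
      ((RatFunc.X : RatFunc K) ∈ P.toValuationSubring ∧ P.ord 𝔣ᵥ(K) = 0 ∧ P.ord 𝔤(K) = 0 ∧
        P.ord (𝔤(K) - 1) = 0 ∧ P.ord 𝔭₁(K, φ) = 0 ∧ P.ord 𝔭₂(K, φ) = 0) := by
  have hut := RatFunc.transcendental_X (K := K)
  have hu1 := finrank_adjoin_ratFunc_X (K := K)
  obtain ⟨hQ0, hF0, hH0, hT0⟩ := ico_ne_zero (K := K)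
  obtain ⟨hd1, hd2, hp10, hp20⟩ := natDegree_radicands (K := K) (5 * φ - 8) (5 * φ + 3)
  obtain ⟨hT, hH, hF, hp1, hp2⟩ := seedI_ne_zero (K := K) φ
  have hv0 : (RatFunc.X : RatFunc K) ≠ 0 := RatFunc.X_ne_zero
  have hordg := ord_seedI (K := K) P
  have hordg1 := ord_seedI_sub_one (K := K) P
  -- `𝔭₁ 𝔭₂ = 𝔣(v)`
  have hpp : 𝔭₁(K, φ) * 𝔭₂(K, φ) = 𝔣ᵥ(K) := by rw [← map_mul, ← icoF_eq_mul hφ]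
  have hordpp : P.ord 𝔭₁(K, φ) + P.ord 𝔭₂(K, φ) = P.ord 𝔣ᵥ(K) := by
    rw [← hpp, P.ord_mul_eq hp1 hp2]
  rcases lt_or_ge (P.ord (RatFunc.X : RatFunc K)) 0 with hneg | hge
  · -- (∞): a pole
    left
    have hvm1 : P.ord (RatFunc.X : RatFunc K) = -1 := P.ord_eq_neg_one_of_finrank_eq_one hut hu1 hneg
    have hoT : P.ord 𝔗ᵥ(K) = -30 := by
      rw [(P.ord_aeval_of_ord_neg hneg hT0).2, natDegree_icoT, hvm1]; norm_num
    have hoH : P.ord ℌᵥ(K) = -20 := by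
      rw [(P.ord_aeval_of_ord_neg hneg hH0).2, natDegree_icoH, hvm1]; norm_num
    have hoF : P.ord 𝔣ᵥ(K) = -11 := by
      rw [(P.ord_aeval_of_ord_neg hneg hF0).2, natDegree_icoF, hvm1]; norm_num
    have ho1 : P.ord 𝔭₁(K, φ) = -6 := by
      rw [(P.ord_aeval_of_ord_neg hneg hp10).2, hd1, hvm1]; norm_num
    have ho2 : P.ord 𝔭₂(K, φ) = -5 := by
      rw [(P.ord_aeval_of_ord_neg hneg hp20).2, hd2, hvm1]; norm_num
    have hg : P.ord 𝔤(K) = -5 := by rw [hordg, hoT, hoF]; norm_num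
    refine ⟨hg, by rw [hordg1, hoH, hoF]; norm_num, Or.inl ⟨ho1, ho2⟩, fun π₀ hπ => ?_⟩
    rw [(P.ord_aeval_of_ord_neg (by rw [hg]; norm_num) hπ).2, hg]
  · -- `v ∈ 𝒪_P`
    have hvO : (RatFunc.X : RatFunc K) ∈ P.toValuationSubring :=
      (P.mem_toValuationSubring_iff_ord_nonneg hv0).2 hge
    have hnnT : 0 ≤ P.ord 𝔗ᵥ(K) := P.ord_nonneg_of_mem (P.aeval_mem hvO _)
    have hnnH : 0 ≤ P.ord ℌᵥ(K) := P.ord_nonneg_of_mem (P.aeval_mem hvO _)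
    have hnnF : 0 ≤ P.ord 𝔣ᵥ(K) := P.ord_nonneg_of_mem (P.aeval_mem hvO _)
    have hnn1 : 0 ≤ P.ord 𝔭₁(K, φ) := P.ord_nonneg_of_mem (P.aeval_mem hvO _)
    have hnn2 : 0 ≤ P.ord 𝔭₂(K, φ) := P.ord_nonneg_of_mem (P.aeval_mem hvO _)
    have hexTF := P.not_and_ord_aeval_pos_of_isCoprime hvO (isCoprime_icoT_icoF (K := K)) hT hF
    have hexTH := P.not_and_ord_aeval_pos_of_isCoprime hvO (isCoprime_icoT_icoH (K := K)) hT hH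
    have hexHF := P.not_and_ord_aeval_pos_of_isCoprime hvO (isCoprime_icoH_icoF (K := K)) hH hF
    rcases hnnF.lt_or_eq with hFpos | hFz
    · -- poles at finite distance: the eleven vertices `𝔣(v) = 0`
      left
      have hTz : P.ord 𝔗ᵥ(K) = 0 := by
        rcases hnnT.lt_or_eq with h | h
        · exact (hexTF ⟨h, hFpos⟩).elim
        · exact h.symm
      have hHz : P.ord ℌᵥ(K) = 0 := by
        rcases hnnH.lt_or_eq with h | h
        · exact (hexHF ⟨h, hFpos⟩).elim
        · exact h.symm
      have hF1 : P.ord 𝔣ᵥ(K) = 1 :=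
        P.ord_aeval_eq_one_of_separable_of_finrank_eq_one hut hu1 (separable_icoF (K := K)) hFpos
      have hg : P.ord 𝔤(K) = -5 := by rw [hordg, hTz, hF1]; norm_num
      refine ⟨hg, by rw [hordg1, hHz, hF1]; norm_num, Or.inr (aux_split hnn1 hnn2 (hordpp.trans hF1)),
        fun π₀ hπ => ?_⟩
      rw [(P.ord_aeval_of_ord_neg (by rw [hg]; norm_num) hπ).2, hg]
    have h12 := aux_zero hnn1 hnn2 (hordpp.trans hFz.symm)
    rcases hnnT.lt_or_eq with hTpos | hTz
    · -- zeros: the edge midpoints `𝔗(v) = 0`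
      right; left
      have hHz : P.ord ℌᵥ(K) = 0 := by
        rcases hnnH.lt_or_eq with h | h
        · exact (hexTH ⟨hTpos, h⟩).elim
        · exact h.symm
      have hT1 : P.ord 𝔗ᵥ(K) = 1 :=
        P.ord_aeval_eq_one_of_separable_of_finrank_eq_one hut hu1 (separable_icoT (K := K)) hTpos
      have hg : P.ord 𝔤(K) = 2 := by rw [hordg, hT1, ← hFz]; norm_num
      refine ⟨hg, by rw [hordg1, hHz, ← hFz]; norm_num, h12.1, h12.2, fun π₀ h0 => ?_⟩
      exact (P.ord_aeval_eq_zero_of_eval_ne_zero (by rw [hg]; norm_num) h0).2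
    rcases hnnH.lt_or_eq with hHpos | hHz
    · -- ones: the face centres `ℌ(v) = 0`
      right; right; left
      have hH1 : P.ord ℌᵥ(K) = 1 :=
        P.ord_aeval_eq_one_of_separable_of_finrank_eq_one hut hu1 (separable_icoH (K := K)) hHpos
      have hg1 : P.ord (𝔤(K) - 1) = 3 := by rw [hordg1, hH1, ← hFz]; norm_num
      refine ⟨by rw [hordg, ← hTz, ← hFz]; norm_num, hg1, h12.1, h12.2, fun π₀ h1 => ?_⟩
      exact ord_aeval_eq_zero_of_ord_sub_one_pos P (by rw [hg1]; norm_num) h1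
    · -- generic
      right; right; right
      exact ⟨hvO, hFz.symm, by rw [hordg, ← hTz, ← hFz]; norm_num,
        by rw [hordg1, ← hHz, ← hFz]; norm_num, h12.1, h12.2⟩

/-- **The seed has a pole** (at `v = 0`), hence is transcendental over `K`.
[cite: Stichtenoth2009, Prop. 1.1.5(c), Cor. 1.1.20] -/
theorem seedI_transcendental : Transcendental K 𝔤(K) := by
  have hut := RatFunc.transcendental_X (K := K)
  obtain ⟨hQ0, -, -, hT0⟩ := ico_ne_zero (K := K)
  obtain ⟨hT, -, hF, -⟩ := seedI_ne_zero (K := K) 0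
  obtain ⟨-, heT, heQ⟩ := ico_eval_zero (K := K)
  obtain ⟨P, hP⟩ := exists_ord_pos_of_transcendental hut
  have hg0 : 𝔤(K) ≠ 0 := seedI_seed_ne_zero
  have hoT : P.ord 𝔗ᵥ(K) = 0 :=
    (P.ord_aeval_eq_zero_of_eval_ne_zero hP (p := 𝔗(K)) (by rw [heT]; exact one_ne_zero)).2
  have hoQ : P.ord (aeval (RatFunc.X : RatFunc K) 𝔮(K)) = 0 :=
    (P.ord_aeval_eq_zero_of_eval_ne_zero hP (p := 𝔮(K)) (by rw [heQ]; norm_num)).2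
  have hQ : aeval (RatFunc.X : RatFunc K) 𝔮(K) ≠ 0 := aeval_ratFunc_X_ne_zero hQ0
  have hoF : P.ord 𝔣ᵥ(K) = P.ord (RatFunc.X : RatFunc K) := by
    rw [icoF_eq_X_mul, map_mul, aeval_X, P.ord_mul_eq RatFunc.X_ne_zero hQ, hoQ, add_zero]
  have hpole : P.ord 𝔤(K) < 0 := by
    rw [ord_seedI, hoT, hoF]; omega
  intro halg
  have hmem := IsAlgFunctionField.mem_valuationSubring_of_isAlgebraic P.toValuationSubring
    P.algebraMap_mem halg
  have := (P.mem_toValuationSubring_iff_ord_nonneg hg0).1 hmem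
  omega

/-- The seed is not annihilated by a non-zero polynomial. [folklore] -/
theorem aeval_seedI_ne_zero {π₀ : K[X]} (hπ : π₀ ≠ 0) : aeval 𝔤(K) π₀ ≠ 0 :=
  fun h => seedI_transcendental (K := K) ⟨π₀, hπ, h⟩

/-- **The other closed points are unramified for the icosahedral seed.** For `π₀` monic irreducible,
`π₀ ∉ {X, X - 1}`, at every zero `P` of `π₀(𝔤)` on the line: `v_P(π₀(𝔤)) = 1`, and `𝔭₁`, `𝔭₂` are
units. The place is generic (`seedI_cases`), and there `v_P(π₀(𝔤)) = v_P(Ñ(v))` for the homogenised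
pull-back of `π₀` under `A/B = 𝔗²/(1728 𝔣⁵)`, separable by `pullback_separable`: `A`, `B` are coprime
and the Wronskian is `1728 𝔗 𝔣⁴ · 5 ℌ²` (`wronskian_ico`), `A - B = -ℌ³`. [folklore] -/
theorem seedI_elsewhere {φ : K} (hφ : φ ^ 2 = φ + 1) {π₀ : K[X]} (hπi : Irreducible π₀)
    (hπm : π₀.Monic) (hπX : π₀ ≠ X) (hπX1 : π₀ ≠ X - 1) (P : PlaceOver K (RatFunc K))
    (hP : 0 < P.ord (aeval 𝔤(K) π₀)) :
    P.ord (aeval 𝔤(K) π₀) = 1 ∧ P.ord 𝔭₁(K, φ) = 0 ∧ P.ord 𝔭₂(K, φ) = 0 := by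
  have hut := RatFunc.transcendental_X (K := K)
  have hu1 := finrank_adjoin_ratFunc_X (K := K)
  have h0 : π₀.eval 0 ≠ 0 := fun h0 => hπX (by
    have h := PlaceOver.eq_X_sub_C_of_irreducible_of_eval_eq_zero hπi hπm h0
    rwa [map_zero, sub_zero] at h)
  have h1 : π₀.eval 1 ≠ 0 := fun h1 => hπX1 (by
    have h := PlaceOver.eq_X_sub_C_of_irreducible_of_eval_eq_zero hπi hπm h1
    rwa [map_one] at h)
  rcases seedI_cases hφ P with ⟨-, -, -, h⟩ | ⟨-, -, -, -, h⟩ | ⟨-, -, -, -, h⟩ | ⟨-, hFz, -, -, hq1, hq2⟩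
  · rw [h π₀ hπi.ne_zero] at hP
    have h5 : (π₀.natDegree : ℤ) * (-5) ≤ 0 :=
      mul_nonpos_of_nonneg_of_nonpos (by positivity) (by norm_num)
    exact absurd hP (not_lt.2 h5)
  · rw [h π₀ h0] at hP; exact (lt_irrefl _ hP).elim
  · rw [h π₀ h1] at hP; exact (lt_irrefl _ hP).elim
  refine ⟨?_, hq1, hq2⟩
  obtain ⟨hT, -, hF, -⟩ := seedI_ne_zero (K := K) 0
  obtain ⟨h1728, ho1728⟩ := seedI_const (K := K) P
  -- the homogenised pull-back of `π₀` under `A/B`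
  set A : K[X] := 𝔗(K) ^ 2 with hA
  set B : K[X] := C (1728 : K) * 𝔣(K) ^ 5 with hB
  set N : K[X] := ∑ j ∈ Finset.range (π₀.natDegree + 1),
    C (π₀.coeff j) * A ^ j * B ^ (π₀.natDegree - j) with hN
  have haB : aeval (RatFunc.X : RatFunc K) B = algebraMap K (RatFunc K) 1728 * 𝔣ᵥ(K) ^ 5 := by
    rw [hB, map_mul, aeval_C, map_pow]
  have haB0 : aeval (RatFunc.X : RatFunc K) B ≠ 0 := by
    rw [haB]; exact mul_ne_zero h1728 (pow_ne_zero _ hF)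
  have hNf : aeval (RatFunc.X : RatFunc K) N = aeval (RatFunc.X : RatFunc K) B ^ π₀.natDegree *
      aeval 𝔤(K) π₀ := by
    rw [hN, aeval_pullback_eq π₀ A B haB0, ← seedI_eq_div]
  have hπf0 : aeval 𝔤(K) π₀ ≠ 0 := aeval_seedI_ne_zero hπi.ne_zero
  have hN0 : N ≠ 0 := by
    intro h
    rw [h, map_zero] at hNf
    exact mul_ne_zero (pow_ne_zero _ haB0) hπf0 hNf.symm
  -- coprimality and the Wronskian
  have hu : IsUnit (C (1728 : K) : K[X]) := isUnit_C.mpr (by norm_num : (1728 : K) ≠ 0).isUnit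
  have hcop : IsCoprime A B := by
    have h1 : IsCoprime (𝔗(K) ^ 2) (C (1728 : K)) := by
      simpa using (isCoprime_mul_unit_left_right hu (𝔗(K) ^ 2) 1).2 isCoprime_one_right
    rw [hA, hB]
    exact h1.mul_right (isCoprime_icoT_icoF (K := K)).pow
  have hW : ∀ ρ : K[X], Irreducible ρ → ρ ∣ derivative A * B - A * derivative B →
      ρ ∣ A ∨ ρ ∣ B ∨ ρ ∣ A - B := by
    intro ρ hρ hdvd
    rw [hA, hB, wronskian_ico] at hdvd
    have hp := hρ.prime
    rcases hp.dvd_or_dvd hdvd with h | h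
    · rcases hp.dvd_or_dvd h with h | h
      · rcases hp.dvd_or_dvd h with h | h
        · exact (hρ.not_isUnit (isUnit_of_dvd_unit h hu)).elim
        · left; rw [hA]; exact h.trans (dvd_pow_self _ two_ne_zero)
      · right; left; rw [hB]
        exact dvd_mul_of_dvd_right ((hp.dvd_of_dvd_pow h).trans (dvd_pow_self _ (by norm_num))) _
    · right; right
      have h5 : ρ ∣ ℌ(K) ^ 2 := by
        rcases hp.dvd_or_dvd h with h | h
        · rw [show (5 : K[X]) = C (5 : K) by rw [map_ofNat]] at h
          exact (hρ.not_isUnit (isUnit_of_dvd_unit h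
            (isUnit_C.mpr (by norm_num : (5 : K) ≠ 0).isUnit))).elim
        · exact h
      have e : A - B = -(ℌ(K) ^ 3) := by
        rw [hA, hB, map_ofNat]
        linear_combination (-1 : K[X]) * icoH_pow_add_icoT_pow (K := K)
      rw [e, dvd_neg]
      exact (hp.dvd_of_dvd_pow h5).trans (dvd_pow_self _ three_ne_zero)
  have hsep : N.Separable := pullback_separable hπi hπm hπX hπX1 hcop hW hN0
  have hordB : P.ord (aeval (RatFunc.X : RatFunc K) B) = 0 := by
    rw [haB, P.ord_mul_eq h1728 (pow_ne_zero _ hF), P.ord_pow hF, hFz, ho1728]; norm_num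
  have hordN : P.ord (aeval (RatFunc.X : RatFunc K) N) = P.ord (aeval 𝔤(K) π₀) := by
    rw [hNf, P.ord_mul_eq (pow_ne_zero _ haB0) hπf0, P.ord_pow haB0, hordB, mul_zero, zero_add]
  have h := P.ord_aeval_eq_one_of_separable_of_finrank_eq_one hut hu1 hsep (by rw [hordN]; exact hP)
  rwa [hordN] at h

/-- **The radicand `h = 𝔭₁ 𝔭₂^{m-1}` of the Kummer layer**: its order is `m`-divisible at the zeros
of `𝔤` (where `v(𝔤) = 2`). [folklore] -/
theorem seedI_zeros {φ : K} (hφ : φ ^ 2 = φ + 1) (m : ℕ) (hm : 0 < m)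
    (P : PlaceOver K (RatFunc K)) (hP : 0 < P.ord 𝔤(K)) :
    P.ord 𝔤(K) = 2 ∧ (m : ℤ) ∣ P.ord (𝔭₁(K, φ) * 𝔭₂(K, φ) ^ (m - 1)) := by
  obtain ⟨-, -, -, hp1, hp2⟩ := seedI_ne_zero (K := K) φ
  have hm1 : ((m - 1 : ℕ) : ℤ) = m - 1 := by rw [Nat.cast_sub hm]; simp
  rw [P.ord_mul_eq hp1 (pow_ne_zero _ hp2), P.ord_pow hp2, hm1]
  rcases seedI_cases hφ P with ⟨hg, -⟩ | ⟨hg, -, ha, hb, -⟩ | ⟨hg, -⟩ | ⟨-, -, hg, -⟩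
  · omega
  · exact ⟨hg, by rw [ha, hb]; simp⟩
  · omega
  · omega

/-- The radicand is a unit at the zeros of `𝔤 - 1` (where `v(𝔤 - 1) = 3`). [folklore] -/
theorem seedI_ones {φ : K} (hφ : φ ^ 2 = φ + 1) (m : ℕ) (hm : 0 < m)
    (P : PlaceOver K (RatFunc K)) (hP : 0 < P.ord (𝔤(K) - 1)) :
    P.ord (𝔤(K) - 1) = 3 ∧ (m : ℤ) ∣ P.ord (𝔭₁(K, φ) * 𝔭₂(K, φ) ^ (m - 1)) := by
  obtain ⟨-, -, -, hp1, hp2⟩ := seedI_ne_zero (K := K) φ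
  have hm1 : ((m - 1 : ℕ) : ℤ) = m - 1 := by rw [Nat.cast_sub hm]; simp
  rw [P.ord_mul_eq hp1 (pow_ne_zero _ hp2), P.ord_pow hp2, hm1]
  rcases seedI_cases hφ P with ⟨-, hg, -⟩ | ⟨-, hg, -⟩ | ⟨-, hg, ha, hb, -⟩ | ⟨-, -, -, hg, -⟩
  · omega
  · omega
  · exact ⟨hg, by rw [ha, hb]; simp⟩
  · omega

/-- At the poles of `𝔤` (`v(𝔤) = -5`) the order of the radicand is `-5m - 1`, `1` or `m - 1`, prime
to `m`. [folklore] -/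
theorem seedI_poles {φ : K} (hφ : φ ^ 2 = φ + 1) (m : ℕ) (hm : 0 < m)
    (P : PlaceOver K (RatFunc K)) (hP : P.ord 𝔤(K) < 0) :
    P.ord 𝔤(K) = -5 ∧ IsCoprime (P.ord (𝔭₁(K, φ) * 𝔭₂(K, φ) ^ (m - 1))) (m : ℤ) := by
  obtain ⟨-, -, -, hp1, hp2⟩ := seedI_ne_zero (K := K) φ
  have hm1 : ((m - 1 : ℕ) : ℤ) = m - 1 := by rw [Nat.cast_sub hm]; simp
  rw [P.ord_mul_eq hp1 (pow_ne_zero _ hp2), P.ord_pow hp2, hm1]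
  rcases seedI_cases hφ P with ⟨hg, -, hab, -⟩ | ⟨hg, -⟩ | ⟨hg, -⟩ | ⟨-, -, hg, -⟩
  · refine ⟨hg, ?_⟩
    rcases hab with ⟨ha, hb⟩ | ⟨ha, hb⟩ | ⟨ha, hb⟩
    · rw [ha, hb]; ring_nf; exact ⟨-1, -5, by ring⟩
    · rw [ha, hb]; simpa using isCoprime_one_left
    · rw [ha, hb]; ring_nf; exact ⟨-1, 1, by ring⟩
  · omega
  · omega
  · omega

/-- At the other closed points the radicand is a unit. [folklore] -/
theorem seedI_elsewhere_dvd {φ : K} (hφ : φ ^ 2 = φ + 1) (m : ℕ) {π₀ : K[X]}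
    (hπi : Irreducible π₀) (hπm : π₀.Monic) (hπX : π₀ ≠ X) (hπX1 : π₀ ≠ X - 1)
    (P : PlaceOver K (RatFunc K)) (hP : 0 < P.ord (aeval 𝔤(K) π₀)) :
    P.ord (aeval 𝔤(K) π₀) = 1 ∧ (m : ℤ) ∣ P.ord (𝔭₁(K, φ) * 𝔭₂(K, φ) ^ (m - 1)) := by
  obtain ⟨-, -, -, hp1, hp2⟩ := seedI_ne_zero (K := K) φ
  obtain ⟨h1, ha, hb⟩ := seedI_elsewhere hφ hπi hπm hπX hπX1 P hP
  refine ⟨h1, ?_⟩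
  rw [P.ord_mul_eq hp1 (pow_ne_zero _ hp2), P.ord_pow hp2, ha, hb]
  simp

end Seed

/-! ### C. One Kummer layer: the covering of signature `(2, 3, 5m)` -/

section Cover

/-- **One Kummer layer over the icosahedral seed: a covering of signature `(2, 3, 5m)`** over (the
full constant field inside `F₁` of) any number field `K` containing `φ` with `φ² = φ + 1`:
`F₁ = K(v)(g)`, `g^m = 𝔭₁ 𝔭₂^{m-1}` (`𝔭₁ = v(v⁵ - (5φ - 8))`, `𝔭₂ = v⁵ + (5φ + 3)`, `𝔣(v) = 𝔭₁ 𝔭₂`),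
and `f = 𝔗(v)²/(1728 𝔣(v)⁵)`. [cite: Stichtenoth2009, Prop. 3.7.3]
[cite: DarmonGranville1995, Prop. 3.1 (p. 525), signature `(2, 3, 5m)`] -/
theorem exists_belyiMap_signature_two_three_five_aux (K : Type u) [Field K] [NumberField K]
    {m : ℕ} (hm : 0 < m) {φ : K} (hφ : φ ^ 2 = φ + 1) :
    ∃ (K' : Type u) (_ : Field K') (_ : NumberField K') (F : Type u) (_ : Field F) (_ : Algebra K' F)
      (_ : IsAlgFunctionField K' F) (_ : IsIntegrallyClosedIn K' F) (f : F),
      f ∉ Set.range (algebraMap K' F) ∧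
      (∀ P : PlaceOver K' F, 0 < P.ord f → P.ord f = 2) ∧
      (∀ P : PlaceOver K' F, 0 < P.ord (f - 1) → P.ord (f - 1) = 3) ∧
      (∀ P : PlaceOver K' F, P.ord f < 0 → P.ord f = -((5 * m : ℕ) : ℤ)) ∧
      (∀ π₀ : K'[X], Irreducible π₀ → π₀.Monic → π₀ ≠ X → π₀ ≠ X - 1 →
        ∀ P : PlaceOver K' F, 0 < P.ord (aeval f π₀) → P.ord (aeval f π₀) = 1) := by
  haveI : CharZero (RatFunc K) :=
    charZero_of_injective_algebraMap (algebraMap K (RatFunc K)).injective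
  have hmK : (m : K) ≠ 0 := Nat.cast_ne_zero.2 hm.ne'
  obtain ⟨-, -, -, hp1, hp2⟩ := seedI_ne_zero (K := K) φ
  have hH0 : (𝔭₁(K, φ) * 𝔭₂(K, φ) ^ (m - 1) : RatFunc K) ≠ 0 := mul_ne_zero hp1 (pow_ne_zero _ hp2)
  -- the Kummer layer
  obtain ⟨F₁, _, _, _, _, _, _, g, hg, hgen⟩ := exists_radical_extension (K := K) (F := RatFunc K)
    (𝔭₁(K, φ) * 𝔭₂(K, φ) ^ (m - 1)) hm
  haveI hAF₁ : IsAlgFunctionField K F₁ :=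
    isAlgFunctionField_of_finiteDimensional (K := K) (F := RatFunc K)
  set f : F₁ := algebraMap (RatFunc K) F₁ 𝔤(K) with hf
  have hft : Transcendental K f :=
    (transcendental_algebraMap_iff (algebraMap (RatFunc K) F₁).injective).2 seedI_transcendental
  have h₀ : ∀ R : PlaceOver K F₁, 0 < R.ord f → R.ord f = 2 := fun R hR =>
    PlaceOver.ord_algebraMap_eq_of_forall_ord_pos_of_dvd (K := K) (F := RatFunc K) (F' := F₁) hm hmK
      hH0 hg hgen (fun Q hQ => seedI_zeros hφ m hm Q hQ) R hR
  have hi' : ∀ R : PlaceOver K F₁, R.ord f < 0 → R.ord f = -((5 * m : ℕ) : ℤ) := fun R hR => by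
    have h := PlaceOver.ord_algebraMap_eq_of_forall_ord_neg_of_isCoprime (K := K) (F := RatFunc K)
      (F' := F₁) hm hH0 hg hgen (p₀ := 5) (fun Q hQ => seedI_poles hφ m hm Q hQ) R hR
    rw [h]; push_cast; ring
  have h₁ : ∀ R : PlaceOver K F₁, 0 < R.ord (f - 1) → R.ord (f - 1) = 3 := by
    intro R hR
    have heq : f - 1 = algebraMap (RatFunc K) F₁ (𝔤(K) - 1) := by
      simp only [hf, map_sub, map_one]
    rw [heq] at hR ⊢
    exact PlaceOver.ord_algebraMap_eq_of_forall_ord_pos_of_dvd (K := K) (F := RatFunc K) (F' := F₁) hm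
      hmK hH0 hg hgen (fun Q hQ => seedI_ones hφ m hm Q hQ) R hR
  have hunr : ∀ π₀ : K[X], Irreducible π₀ → π₀.Monic → π₀ ≠ X → π₀ ≠ X - 1 →
      ∀ R : PlaceOver K F₁, 0 < R.ord (aeval f π₀) → R.ord (aeval f π₀) = 1 := by
    intro π₀ hπi hπm hX hX1 R hR
    have heq : aeval f π₀ = algebraMap (RatFunc K) F₁ (aeval 𝔤(K) π₀) := by
      rw [hf, aeval_algebraMap_apply]
    rw [heq] at hR ⊢
    exact PlaceOver.ord_algebraMap_eq_of_forall_ord_pos_of_dvd (K := K) (F := RatFunc K) (F' := F₁) hm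
      hmK hH0 hg hgen (fun Q hQ => seedI_elsewhere_dvd hφ m hπi hπm hX hX1 Q hQ) R hR
  obtain ⟨K', _, _, _, _, _, hfK', h₀', h₁', hi'', hunr'⟩ :=
    exists_fullConstantField_of_signature (K := K) (F := F₁) hft h₀ h₁ hi' hunr
  exact ⟨K', inferInstance, inferInstance, F₁, inferInstance, inferInstance, inferInstance,
    inferInstance, f, hfK', h₀', h₁', hi'', hunr'⟩

/-- **A covering of signature `(2, 3, 5m)` over a number field, for every `m ≥ 1`**, in the shape of
the covering input of `finite_properSolutions_of_belyiMap_of_faltings`: the construction over the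
cyclotomic field `ℚ(ζ₅)` with the golden ratio `φ = -(ζ² + ζ³) = 1 + ζ + ζ⁴`.
[cite: Stichtenoth2009, Prop. 3.7.3] [cite: DarmonGranville1995, Prop. 3.1 (p. 525), signature `(2, 3, 5m)`] -/
theorem exists_belyiMap_signature_two_three_five {m : ℕ} (hm : 0 < m) :
    ∃ (K : Type) (_ : Field K) (_ : NumberField K) (F : Type) (_ : Field F) (_ : Algebra K F)
      (_ : IsAlgFunctionField K F) (_ : IsIntegrallyClosedIn K F) (f : F),
      f ∉ Set.range (algebraMap K F) ∧
      (∀ P : PlaceOver K F, 0 < P.ord f → P.ord f = 2) ∧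
      (∀ P : PlaceOver K F, 0 < P.ord (f - 1) → P.ord (f - 1) = 3) ∧
      (∀ P : PlaceOver K F, P.ord f < 0 → P.ord f = -((5 * m : ℕ) : ℤ)) ∧
      (∀ π₀ : K[X], Irreducible π₀ → π₀.Monic → π₀ ≠ X → π₀ ≠ X - 1 →
        ∀ P : PlaceOver K F, 0 < P.ord (aeval f π₀) → P.ord (aeval f π₀) = 1) := by
  haveI : NeZero (5 : ℕ) := ⟨by norm_num⟩
  obtain ⟨ζ, hζ⟩ := @IsCyclotomicExtension.exists_isPrimitiveRoot {5} ℚ (CyclotomicField 5 ℚ) _ _ _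
    (CyclotomicField.isCyclotomicExtension 5 ℚ) 5 (Set.mem_singleton 5) (NeZero.ne 5)
  have h5 : ζ ^ 5 = 1 := hζ.pow_eq_one
  have h1 : ζ ^ 1 ≠ 1 := hζ.pow_ne_one_of_pos_of_lt one_ne_zero (by norm_num)
  have hrel : ζ ^ 4 + ζ ^ 3 + ζ ^ 2 + ζ + 1 = 0 := by
    have h : (ζ - 1) * (ζ ^ 4 + ζ ^ 3 + ζ ^ 2 + ζ + 1) = 0 := by linear_combination h5
    exact (mul_eq_zero.mp h).resolve_left (sub_ne_zero.mpr (by simpa using h1))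
  -- the golden ratio `φ = -(ζ² + ζ³)`
  have hφ : (-(ζ ^ 2 + ζ ^ 3)) ^ 2 = -(ζ ^ 2 + ζ ^ 3) + 1 := by
    linear_combination hrel + (2 + ζ) * h5
  exact exists_belyiMap_signature_two_three_five_aux (CyclotomicField 5 ℚ) hm hφ

end Cover

end AlgFunctionField

/-! ### D. Darmon–Granville for the signatures `(2, 3, r)`, `5 ∣ r ≥ 10`, and all `r ≥ 8` not prime to `30`, modulo Faltings -/

section DarmonGranville

open AlgFunctionField

/-- **`A x² + B y³ = C z^{5m}` has finitely many proper solutions for `m ≥ 2`, modulo Faltings'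
theorem** (`finite_ratPlaces_of_two_le_genus`): the covering `exists_belyiMap_signature_two_three_five`
fed into `finite_properSolutions_of_belyiMap_of_faltings`; `(2, 3, 5m)` is hyperbolic iff `m ≥ 2`.
No Riemann existence theorem is used. [cite: DarmonGranville1995, Theorem 2 (p. 515)] -/
theorem finite_properSolutions_signature_two_three_five_of_faltings {m : ℕ} (hm : 2 ≤ m)
    (hFaltings : ∀ (K' : Type) [Field K'] (F' : Type) [Field F'] [Algebra K' F'],
      finite_ratPlaces_of_two_le_genus K' F')
    {A B C : ℤ} (hA : A ≠ 0) (hB : B ≠ 0) (hC : C ≠ 0) :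
    {t : ℤ × ℤ × ℤ | ({t.1, t.2.1, t.2.2} : Finset ℤ).gcd id = 1 ∧
      A * t.1 ^ 2 + B * t.2.1 ^ 3 = C * t.2.2 ^ (5 * m)}.Finite := by
  obtain ⟨K, _, _, F, _, _, _, _, f, hf, h₀, h₁, hi, hunr⟩ :=
    exists_belyiMap_signature_two_three_five (m := m) (by omega)
  have hhyp : 3 * (5 * m) + 5 * m * 2 + 2 * 3 < 2 * 3 * (5 * m) := by ring_nf; omega
  exact finite_properSolutions_of_belyiMap_of_faltings hhyp hf h₀ h₁ hi hunr hFaltings hA hB hC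

/-- **`A x^r + B y² = C z³` has finitely many proper solutions for every `r ≥ 10` divisible by `5`,
modulo Faltings' theorem only** — in particular for `r = 25`, whose triangle group `Δ(2, 3, 25)` is
perfect. [cite: DarmonGranville1995, Theorem 2 (p. 515)] -/
theorem finite_properSolutions_signature_five_two_three_of_faltings {r : ℕ} (hr : 10 ≤ r) (h5 : 5 ∣ r)
    (hFaltings : ∀ (K' : Type) [Field K'] (F' : Type) [Field F'] [Algebra K' F'],
      finite_ratPlaces_of_two_le_genus K' F')
    {A B C : ℤ} (hA : A ≠ 0) (hB : B ≠ 0) (hC : C ≠ 0) :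
    {t : ℤ × ℤ × ℤ | ({t.1, t.2.1, t.2.2} : Finset ℤ).gcd id = 1 ∧
      A * t.1 ^ r + B * t.2.1 ^ 2 = C * t.2.2 ^ 3}.Finite := by
  obtain ⟨m, rfl⟩ := h5
  have h23 : ∀ A B C : ℤ, A ≠ 0 → B ≠ 0 → C ≠ 0 →
      {t : ℤ × ℤ × ℤ | ({t.1, t.2.1, t.2.2} : Finset ℤ).gcd id = 1 ∧
        A * t.1 ^ 2 + B * t.2.1 ^ 3 = C * t.2.2 ^ (5 * m)}.Finite := fun A B C hA hB hC =>
    finite_properSolutions_signature_two_three_five_of_faltings (by omega) hFaltings hA hB hC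
  exact forall_finite_properSolutions_swap₁₂ (forall_finite_properSolutions_swap₂₃ h23) A B C hA hB hC

/-- **`A x^r + B y² = C z³` has finitely many proper solutions for every `r ≥ 8` not prime to `30`
(`2 ∣ r`, `3 ∣ r` or `5 ∣ r`), modulo Faltings' theorem only** — the union of the dihedral,
tetrahedral (`finite_properSolutions_signature_r_two_three_of_faltings`) and icosahedral
constructions. The remaining `r` (prime to `30`: `7, 11, 13, 17, …, 49, 77, …`) are not treated.
[cite: DarmonGranville1995, Theorem 2 (p. 515)] -/
theorem finite_properSolutions_signature_r_two_three_of_faltings_of_not_coprime_thirty {r : ℕ}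
    (hr : 8 ≤ r) (h235 : 2 ∣ r ∨ 3 ∣ r ∨ 5 ∣ r)
    (hFaltings : ∀ (K' : Type) [Field K'] (F' : Type) [Field F'] [Algebra K' F'],
      finite_ratPlaces_of_two_le_genus K' F')
    {A B C : ℤ} (hA : A ≠ 0) (hB : B ≠ 0) (hC : C ≠ 0) :
    {t : ℤ × ℤ × ℤ | ({t.1, t.2.1, t.2.2} : Finset ℤ).gcd id = 1 ∧
      A * t.1 ^ r + B * t.2.1 ^ 2 = C * t.2.2 ^ 3}.Finite := by
  by_cases h23 : 2 ∣ r ∨ 3 ∣ r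
  · exact finite_properSolutions_signature_r_two_three_of_faltings hr h23 hFaltings hA hB hC
  · have h5 : 5 ∣ r := by tauto
    have h10 : 10 ≤ r := by omega
    exact finite_properSolutions_signature_five_two_three_of_faltings h10 h5 hFaltings hA hB hC

end DarmonGranville

end Literature.NumberTheory.DiophantineGeometry
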